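import Summits.ResolutionOfSingularities.ResolutionOfSingularities.Theorems.WildPurityWildSymbolFrobeniusBlind
import Summits.ResolutionOfSingularities.ResolutionOfSingularities.Theorems.WildPurityPurityTransfer
import HarnessLib

/-!
# `WildSymbol` (stmt-ResolutionOfSingularities-17133), line `birth` — no witness at a REGULAR point
# (modulo Gros–Suwa 1988): the `e = 0` slice of sandwich purity holds

Support file for crux #2 of route `ResolutionOfSingularities/WildPurity`
(`Summit.ResolutionOfSingularities.ResolutionOfSingularities.Theses.WildPurity.WildSymbol`), line `birth`.
Companions: `Theorems/WildPurityWildSymbolSandwich.lean` ("sandwich purity" SP, written out inline: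
purity at a valuation dominating a `p`-radical enlargement of a REGULAR germ; `¬ SP → WildSymbol`),
`Theorems/WildPurityWildSymbolSandwichTemkin.lean` (`Temkin2013Relative → (WildSymbol ↔ ¬ SP)`) and the crux
`PurityTransfer`'s closure modulo Gersten purity, `Theorems/WildPurityPurityTransfer.lean`
(`gerstenTransport_of_grosSuwa1988`, `stub_regularChart`, `stub_heightOneValuationRing`, `placeOfPrime`).

## What is proved (all conditional on the tree's named fact `GrosSuwa1988_purity`, Gros–Suwa 1988 Thm. 1.4)

* `mem_Unr_of_divIntegral_of_isRegularLocalRing` — if the local ring of the point `locAt B O` of a model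
  `B ⊆ O` (`B` finitely generated, `Frac B = K`) is REGULAR, then (D) for `B` forces `α ∈ Unr(O)`. This is
  `PurityTransfer` with the resolution hypothesis replaced by regularity AT the centre (the only thing the
  proof of `PurityTransfer_of_grosSuwa1988` uses after the valuative-criterion lift): regularity spreads to a
  chart `A' ⊆ O` (`stub_regularChart`, J-2), the height-one localisations of `A'` through the centre are
  tested divisorial places, Gersten purity at the centre (`gerstenTransport_of_grosSuwa1988`), local
  domination `A'_𝔮 ⊆ O`. The local ring `locAt B O ⊆ K` is identified with `Localization.AtPrime` of the
  centre ideal (`locAt_eq_localizationIn`).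
* `not_wildSymbol_at_regular_point_of_grosSuwa1988` — CALIBRATION (negative lemma): modulo Gros–Suwa, no
  witness of the crux has a regular point `locAt R O` (the crux with the extra hypothesis
  `IsRegularLocalRing (locAt R O)` is false). Witness points are SINGULAR on every `p`-radically closed
  model through them — in the sandwich form: the exponent `e` of SP must be `≥ 1` for a failure, i.e. the
  `e = 0` slice of sandwich purity (`Frac B = K`) holds:
* `sandwichPurity_exponent_zero_of_grosSuwa1988` — SP restricted to `e = 0`, from `GrosSuwa1988_purity`.

No definition is declared; nothing here concludes the crux positively.
-/

noncomputable section

-- single-problem summit: the doubled namespace component `ResolutionOfSingularities` is forced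
set_option linter.dupNamespace false

namespace Summit.ResolutionOfSingularities.ResolutionOfSingularities.Theorems.WildSymbol.Birth

open Summit.ResolutionOfSingularities.ResolutionOfSingularities.Theses.WildPurity (WildSymbol)
open Summit.ResolutionOfSingularities.ResolutionOfSingularities.Theorems.WildPurityPurityTransfer
  (pairIntegral_mono localizationIn_centre_subset gerstenTransport_of_grosSuwa1988 stub_regularChart
    stub_heightOneValuationRing)
open Literature.AlgebraicGeometry.Resolution
open Literature.NumberTheory.GaloisCohomology
open Literature.NumberTheory.GaloisCohomology.KatoCohomologySymbolic

variable {k K : Type} [Field k] [Field K] [Algebra k K]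

/-- **The local ring of the point, two constructions.** For a model `B ⊆ O` with `Frac B = K`, the subring
`locAt B O ⊆ K` (fractions `b/s`, `s ∈ B ∖ 𝔪_O`) is the carrier of the localisation of `B` at the centre
ideal `𝔪_O ∩ B` realised inside `K` (`localizationIn K (centreIdeal B O h)`). [folklore] -/
theorem locAt_eq_localizationIn (B : Subalgebra k K) [IsFractionRing B K] (O : ValuationSubring K)
    (h : B.toSubring ≤ O.toSubring) :
    locAt (B : Set K) O = (localizationIn K (centreIdeal B O h)).toSubring := by
  ext x
  rw [mem_locAt_iff]
  constructor
  · rintro ⟨r, s, hr, hs, hsO, hxs⟩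
    refine (mem_localizationIn_iff (centreIdeal B O h) x).mpr ⟨⟨r, hr⟩, ⟨s, hs⟩, ?_, hxs⟩
    exact fun hmem => hsO ((mem_centreIdeal_iff_coe_mem_nonunits B O h ⟨s, hs⟩).mp hmem)
  · intro hx
    obtain ⟨a, s, hs, hxs⟩ := (mem_localizationIn_iff (centreIdeal B O h) x).mp hx
    exact ⟨a, s, a.2, s.2,
      fun hmem => hs ((mem_centreIdeal_iff_coe_mem_nonunits B O h s).mpr hmem), hxs⟩

/-- **No witness at a regular point, modulo Gros–Suwa: (D) at a regular point forces `O`-integrality.**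
For `p` prime, `k` perfect of characteristic `p`, `O ⊇ k` a valuation ring of `K`, `B ⊆ O` finitely
generated with `Frac B = K` and `locAt B O` a regular local ring, every `α ∈ G ⧸ N` satisfying (D) for `B`
lies in `Unr(O)`. Proof = the proof of `PurityTransfer_of_grosSuwa1988` from its step (2) on: regular chart
`A' ⊇ B` inside `O` (`stub_regularChart`), Gersten purity at the centre of `O` on `A'`
(`gerstenTransport_of_grosSuwa1988`) fed by (D) at the divisorial places `A'_P` (`ht P = 1`, `P ⊆ 𝔮`;
`placeOfPrime`, `stub_heightOneValuationRing`), local domination `A'_𝔮 ⊆ O`. The crux's `G ⧸ N`, `Unr` are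
the pair presentation `H3Pair`, `pairIntegral` definitionally. [cite: GrosSuwa1988, Thm. 1.4] -/
theorem mem_Unr_of_divIntegral_of_isRegularLocalRing (hGS : GrosSuwa1988_purity.{0}) {p : ℕ}
    (hp : p.Prime) [CharP k p] [PerfectField k] (O : ValuationSubring K) (B : Subalgebra k K) (hBfg : B.FG)
    (hBO : B.toSubring ≤ O.toSubring) (hBfr : IsFractionRing B K)
    (hreg : IsRegularLocalRing (locAt (B : Set K) O)) (α : G K ⧸ N p K) (hdiv : DivIntegral p k K B O α) :
    α ∈ Unr p K O.toSubring := by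
  haveI : IsFractionRing B K := hBfr
  -- regularity at the centre, in the `Localization.AtPrime` form
  let 𝔮 : Ideal B := centreIdeal B O hBO
  haveI : IsLocalization.AtPrime (localizationIn K 𝔮) 𝔮 :=
    Localization.subalgebra.isLocalization_ofField K 𝔮.primeCompl 𝔮.primeCompl_le_nonZeroDivisors
  have hreg1 : IsRegularLocalRing (localizationIn K 𝔮) := by
    have e : (locAt (B : Set K) O) ≃+* (localizationIn K 𝔮).toSubring :=
      RingEquiv.subringCongr (locAt_eq_localizationIn B O hBO)
    haveI := hreg
    exact IsRegularLocalRing.of_ringEquiv e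
  have hreg0 : IsRegularLocalRing (Localization.AtPrime 𝔮) := by
    haveI := hreg1
    exact IsRegularLocalRing.of_ringEquiv (R := localizationIn K 𝔮)
      (Localization.algEquiv 𝔮.primeCompl (localizationIn K 𝔮)).symm.toRingEquiv
  -- (2) spread regularity to an affine chart `A'` inside `O`
  obtain ⟨A', hBA', hA'O, hA'fg, hreg'⟩ := stub_regularChart k K O B hBO hBfg hBfr hreg0
  haveI hA'fr : IsFractionRing A' K := isFractionRing_of_le hBA' hBfr
  -- (3) purity at the centre `𝔮' = 𝔪_O ∩ A'`, fed by (D) at the places `A'_P`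
  have key : (α : H3Pair p K) ∈ pairIntegral p (localizationIn K (centreIdeal A' O hA'O) : Set K) := by
    refine gerstenTransport_of_grosSuwa1988 hGS p hp k K A' hA'fg (centreIdeal A' O hA'O) (hreg' _) α ?_
    intro P _ hP1 hPle
    have hPval : ValuationRing (Localization.AtPrime P) :=
      stub_heightOneValuationRing k K A' P (hreg' P) hP1
    exact hdiv (placeOfPrime A' P hPval) (algebraMap_mem_placeOfPrime A' P hPval)
      (isDiscreteValuationRing_placeOfPrime A' P hPval hA'fg (Ideal.ne_bot_of_height_eq_one hP1))
      ⟨A', hA'fg, le_placeOfPrime A' P hPval,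
        fun x hx => exists_mul_eq_of_mem_placeOfPrime A' P hPval hx⟩
      (fun x hx => le_placeOfPrime A' P hPval (hBA' hx))
      (fun x hxR hxW =>
        (mem_centreIdeal_iff_coe_mem_nonunits A' O hA'O ⟨x, hBA' hxR⟩).mp
          (hPle ((coe_mem_nonunits_placeOfPrime_iff A' P hPval ⟨x, hBA' hxR⟩).mp hxW)))
  -- (4) local domination `A'_𝔮' ⊆ O` and monotonicity
  exact pairIntegral_mono p (localizationIn_centre_subset O A' hA'O) key

/-- **CALIBRATION (negative lemma, modulo Gros–Suwa 1988): no `WildSymbol` witness at a regular point.**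
The crux with the extra hypothesis "the local ring `locAt R O` of the affine model at the centre of `O` is a
regular local ring" is FALSE, given `GrosSuwa1988_purity`: witness points are singular on every model through
them (and, by `divIntegral_iff_of_pRadical`, on every `p`-radical enlargement). [cite: GrosSuwa1988, Thm. 1.4] -/
theorem not_wildSymbol_at_regular_point_of_grosSuwa1988 (hGS : GrosSuwa1988_purity.{0}) :
    ¬ ∃ p : ℕ, p.Prime ∧ ∃ (k K : Type) (_ : Field k) (_ : CharP k p) (_ : PerfectField k) (_ : Field K)
      (_ : Algebra k K), (⊤ : IntermediateField k K).FG ∧ ∃ O : ValuationSubring K,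
      (∀ c : k, algebraMap k K c ∈ O) ∧ ∃ R : Subalgebra k K, R.FG ∧ R.toSubring ≤ O.toSubring ∧
      IsFractionRing R K ∧ IsRegularLocalRing (locAt (R : Set K) O) ∧
      ∃ α : G K ⧸ N p K, DivIntegral p k K R O α ∧ α ∉ Unr p K O.toSubring := by
  rintro ⟨p, hp, k, K, _, _, _, _, _, -, O, -, R, hR, hRO, hfr, hreg, α, hdiv, hα⟩
  exact hα (mem_Unr_of_divIntegral_of_isRegularLocalRing hGS hp O R hR hRO hfr hreg α hdiv)

/-- **The `e = 0` slice of sandwich purity holds modulo Gros–Suwa 1988**: the statement SP of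
`Theorems/WildPurityWildSymbolSandwich.lean` with the `p`-radicality hypothesis strengthened to exponent
`0` (`x·s = y`: `Frac B = K`). So a failure of SP (equivalently, given Temkin 2013, a witness of the crux)
needs a GENUINE sandwich, `[K : Frac B] ≥ p`. [cite: GrosSuwa1988, Thm. 1.4] -/
theorem sandwichPurity_exponent_zero_of_grosSuwa1988 (hGS : GrosSuwa1988_purity.{0}) :
    ∀ p : ℕ, p.Prime → ∀ (k K : Type) [Field k] [CharP k p] [PerfectField k] [Field K] [Algebra k K],
      (⊤ : IntermediateField k K).FG → ∀ O : ValuationSubring K, (∀ c : k, algebraMap k K c ∈ O) →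
      ∀ B : Subalgebra k K, B.FG → B.toSubring ≤ O.toSubring →
      (∀ x : K, ∃ y s : K, y ∈ B ∧ s ∈ B ∧ s ≠ 0 ∧ x ^ (p ^ 0) * s = y) →
      IsRegularLocalRing (locAt (B : Set K) O) →
      ∀ α : G K ⧸ N p K, DivIntegral p k K B O α → α ∈ Unr p K O.toSubring := by
  intro p hp k K _ _ _ _ _ _ O _ B hBfg hBO hrad hreg α hdiv
  have hBfr : IsFractionRing B K := by
    refine IsFractionRing.of_field B K fun z => ?_
    obtain ⟨y, s, hy, hs, hs0, hz⟩ := hrad z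
    rw [pow_zero, pow_one] at hz
    exact ⟨⟨y, hy⟩, ⟨s, hs⟩, by show z = y / s; rw [eq_div_iff hs0]; exact hz⟩
  exact mem_Unr_of_divIntegral_of_isRegularLocalRing hGS hp O B hBfg hBO hBfr hreg α hdiv

end Summit.ResolutionOfSingularities.ResolutionOfSingularities.Theorems.WildSymbol.Birth

end
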